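import Literature.Geometry.Lorentzian.Stationary
import Literature.Geometry.Lorentzian.Einstein
import Literature.Geometry.Lorentzian.Geodesic
import HarnessLib

/-!
# Complete stationary vacuum space-times are flat (Anderson 2000)

This Literature file vendors, as a **named fact** (D-0014), M. T. Anderson's rigidity theorem for
geodesically complete stationary solutions of the vacuum Einstein equations, *On stationary vacuum
solutions to the Einstein equations*, Ann. Henri Poincaré 1 (2000) 977–994 = arXiv:gr-qc/0001091,
**Theorem 0.1** — the version *without any asymptotic flatness hypothesis* of Lichnerowicz's
theorem "a geodesically complete stationary vacuum space-time with complete asymptotically flat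
orbit space is Minkowski space" — in the vocabulary of the Lorentz prelude (`Stationary`,
`Einstein`, `Geodesic`, `Curvature`). It is wanted as a hypothesis by route
`FinalStateConjecture/NoParkingWithoutHorizon` (crux `NoVacuumBreathers`, layer-2
`DefectCoercivity`).

## The printed statements (Anderson 2000, §0)

* Setting (p. 1): "A stationary space-time `(M, g)` is a 4-manifold `M` with a smooth Lorentzian
  metric `g`, of signature `(−, +, +, +)`, which has a smooth 1-parameter group `G ≈ ℝ` of
  isometries whose orbits are time-like curves in `M`. We assume throughout the paper that `M` is
  a chronological space-time, i.e. `M` admits no closed time-like curves". The infinitesimal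
  generator of `G` is a time-like Killing vector field `X`, non-vanishing on `M`. "The vacuum
  Einstein field equations on the space-time `(M, g)` are `r_M = 0`" ((0.3), `r_M` the Ricci
  curvature). §1.1: "a space-time `(M, g)` is geodesically complete if all geodesics in `(M, g)`,
  parametrized by an affine parameter `s`, are defined for all `s ∈ ℝ`."
* **Theorem 0.1.** "Let `(M, g)` be a geodesically complete, chronological, stationary vacuum
  space-time. Then `(M, g)` is the flat (i.e. empty) Minkowski space `(ℝ⁴, η)`, or a quotient of
  Minkowski space by a discrete group `Γ` of isometries of `ℝ³`, commuting with `G`. In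
  particular, `M` is diffeomorphic to `S × ℝ`, `dθ = 0` and `u = const`."
* **Theorem 0.2** (not vendored, see below). "There is a constant `K < ∞` such that if `(M, g)` is
  any chronological stationary vacuum solution, (not geodesically complete), then
  `|R_M|[x] ≤ K/ρ²[x]`, where `R_M` is the curvature tensor of `(M, g)`, `[x]` is the Killing
  orbit through `x ∈ M` and `ρ(x) = dist_{g_S}([x], ∂S)`. The constant `K` is independent of the
  data `(M, g)`." Here `(S, g_S)` is the orbit space with the quotient Riemannian metric and
  `∂S = S̄ ∖ S` its metric (Cauchy) boundary.

## Main definitions (namespace `Literature.Geometry.Lorentzian`)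

* `Anderson2000_completeStationaryVacuumFlat` — the named fact: every four-dimensional spacetime
  `𝓢 : Spacetime 4` (connected, Hausdorff, second countable, `C^∞` metric, time-oriented)
  carrying a complete Killing field `X` which is (future-directed) timelike at **every** point
  (`𝓢.IsStationaryKilling X univ`, the prelude's stationarity predicate with `M_ext = M`), which
  is chronological (`IsChronological`), vacuum (`IsRicciFlat`) and geodesically complete
  (`IsGeodesicallyComplete 𝓢.metric.leviCivita`: every geodesic of the Levi-Civita connection
  extends to all of `ℝ`), is **flat**: the curvature tensor of its Levi-Civita connection
  vanishes (`CovariantDerivative.IsFlat`).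
* `Anderson2000_completeStationaryVacuumFlat.apply` — hypothesis form.

## Design choices (faithfulness)

* **Hypotheses.** A complete Killing field generates a smooth one-parameter group of isometries
  (its flow, O'Neill 1983, Ch. 9, Prop. 9.30 ff.); everywhere-timelike `X` makes the orbits
  time-like curves, and the chronology condition makes the `ℝ`-action free (a periodic timelike
  orbit would be a closed timelike curve), so `G ≈ ℝ` as in the printed setting. The prelude's
  `IsStationaryKilling` additionally asks `X` to be *future-directed* on `M_ext = univ` — an extra
  hypothesis (by connectedness an everywhere-timelike continuous field lies in one cone, so this
  only fixes the time orientation), allowed for a named fact, which may only *add* hypotheses.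
  Geodesic completeness is the full (timelike, null **and spacelike**) notion
  `IsGeodesicallyComplete` of `Geodesic.lean`, exactly as printed (§1.1) — **not** the weaker
  causal completeness `IsCausalGeodesicallyComplete` mentioned in the work-item, under which the
  fact would assert more than Theorem 0.1 prints (Anderson's proof uses completeness of the orbit
  space `(S, g_S)`, equivalent to full geodesic completeness of `(M, g)` by his Lemma 1.1).
* **Conclusion.** We vendor the consequence "`(M, g)` is flat" (`Rm = 0`, `IsFlat` of the
  Levi-Civita connection) of the printed conclusion "Minkowski space or a quotient of Minkowski
  space by a discrete group of isometries" — strictly weaker, which is allowed for a named fact,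
  and what the requesting route consumes (`… → 𝒟.metric.leviCivita.IsFlat`). The global
  splitting `M ≅ S × ℝ`, `dθ = 0`, `u = const` is not vendored (no orbit space in the prelude).
* **Theorem 0.2 is not vendored.** Its statement needs the orbit space `S = M/G` as a smooth
  `3`-manifold with the quotient Riemannian metric `g_S`, its metric completion `S̄` and the
  distance `ρ` to `∂S = S̄ ∖ S`, and a pointwise norm `|R_M|` of the space-time curvature (measured,
  as in Anderson 2004, §5, in the frame adapted to the unit timelike `X/|X|`); none of these is a
  prelude notion, and a transcription under any simplified distance would not be the printed
  estimate. A route needing the `ε`-regularity / curvature-decay form should file a definition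
  request for the stationary orbit data `(S, g_S, u, θ)` first.
* **Not a restatement.** `lean search` finds no statement of Anderson's or Lichnerowicz's theorem
  in the tree (`BoundedGeometry.lean` only cites Anderson 2000, Thm. 0.2, Lemmas 1.3–1.4 as
  motivation for its *hypothesis* structures); positive-mass rigidity (`PositiveMassRigidity.lean`,
  flatness of *Riemannian* `3`-manifolds of zero mass) is a different theorem.

## References

* M. T. Anderson, *On stationary vacuum solutions to the Einstein equations*, Ann. Henri Poincaré
  1 (2000) 977–994, doi:10.1007/PL00001021, arXiv:gr-qc/0001091: §0, Thm. 0.1, Thm. 0.2; §1.1,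
  Lemma 1.1 (key `Anderson2000`).
* A. Lichnerowicz, *Théories relativistes de la gravitation et de l'électromagnétisme*, Masson
  1955, §90 (the asymptotically flat case; cited as [L, §90] by Anderson 2000, §0).
* B. O'Neill, *Semi-Riemannian geometry*, Academic Press 1983, Ch. 3 (flatness, completeness),
  Ch. 9 (Killing fields and their flows), Ch. 14 (chronology) (key `ONeill1983`).
-/

noncomputable section

open Bundle Set Manifold TopologicalSpace
open scoped ContDiff Topology Manifold

universe u

namespace Literature.Geometry.Lorentzian

/-- **Anderson 2000, Theorem 0.1 (complete stationary vacuum space-times are flat)**, named fact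
(D-0014), flatness-consequence form. Let `𝓢` be a four-dimensional spacetime (connected,
Hausdorff, second countable, `C^∞` Lorentzian metric `g`, time orientation `τ`) with a vector
field `X` which is a **complete Killing field, timelike (and future-directed) at every point**
(`𝓢.IsStationaryKilling X univ` — Anderson's "stationary": a smooth one-parameter group `G ≈ ℝ`
of isometries with time-like orbits), such that `(M, g)` is **chronological** (no closed timelike
curves, `IsChronological`), **vacuum** (`Ric(g) = 0`, `IsRicciFlat`) and **geodesically
complete** (every geodesic of the Levi-Civita connection — timelike, null or spacelike — is
defined on all of `ℝ`, `IsGeodesicallyComplete`). Then `(M, g)` is **flat**: the curvature tensor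
of its Levi-Civita connection vanishes identically (`CovariantDerivative.IsFlat`). As printed the
conclusion is stronger — "`(M, g)` is the flat (i.e. empty) Minkowski space `(ℝ⁴, η)`, or a
quotient of Minkowski space by a discrete group `Γ` of isometries of `ℝ³`, commuting with `G`. In
particular, `M` is diffeomorphic to `S × ℝ`, `dθ = 0` and `u = const`" — of which flatness is the
part expressible in the prelude. The standing Levi-Civita hypothesis `[𝓢.metric.HasLeviCivita]`
is bound inside (Killing equation, Ricci and curvature tensors, geodesics). Anderson, Ann. Henri
Poincaré 1 (2000), Thm. 0.1 (with §0 for "stationary", "chronological", (0.3), and §1.1 for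
geodesic completeness). [cite: Anderson2000, Thm. 0.1] -/
def Anderson2000_completeStationaryVacuumFlat : Prop :=
  ∀ (𝓢 : Spacetime.{u} 4) [𝓢.metric.HasLeviCivita]
    (X : Π x : 𝓢.carrier, TangentSpace (𝓡 4) x),
    𝓢.IsStationaryKilling X univ →
    𝓢.metric.IsChronological 𝓢.timeOrientation →
    𝓢.metric.toPseudoRiemannianMetric.IsRicciFlat →
    IsGeodesicallyComplete 𝓢.metric.toPseudoRiemannianMetric.leviCivita →
    𝓢.metric.toPseudoRiemannianMetric.leviCivita.IsFlat

/-- **Anderson 2000, Theorem 0.1, hypothesis form.** Given the named fact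
`Anderson2000_completeStationaryVacuumFlat`, a four-dimensional chronological vacuum spacetime
with a complete everywhere-timelike Killing field, all of whose geodesics are complete, has flat
Levi-Civita connection. Tautological unfolding. [folklore] -/
theorem Anderson2000_completeStationaryVacuumFlat.apply
    (h : Anderson2000_completeStationaryVacuumFlat.{u}) (𝓢 : Spacetime.{u} 4)
    [𝓢.metric.HasLeviCivita] (X : Π x : 𝓢.carrier, TangentSpace (𝓡 4) x)
    (hX : 𝓢.IsStationaryKilling X univ) (hchr : 𝓢.metric.IsChronological 𝓢.timeOrientation)
    (hvac : 𝓢.metric.toPseudoRiemannianMetric.IsRicciFlat)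
    (hcpl : IsGeodesicallyComplete 𝓢.metric.toPseudoRiemannianMetric.leviCivita) :
    𝓢.metric.toPseudoRiemannianMetric.leviCivita.IsFlat :=
  h 𝓢 X hX hchr hvac hcpl

/-- Under the hypotheses of Anderson's theorem the stationary Killing field vanishes nowhere (it
is timelike at every point, and `g(0, 0) = 0` is not negative): the orbits of `G` are
non-degenerate curves, as in Anderson 2000, §0 ("since `X` is non-vanishing on `M`"). [cite: Anderson2000, §0] -/
theorem IsStationaryKilling.ne_zero_of_univ {𝓢 : Spacetime.{u} 4} [𝓢.metric.HasLeviCivita]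
    {X : Π x : 𝓢.carrier, TangentSpace (𝓡 4) x} (hX : 𝓢.IsStationaryKilling X univ)
    (x : 𝓢.carrier) : X x ≠ 0 := by
  intro h0
  have ht := (hX.isTimelike (mem_univ x)).1
  rw [LorentzianMetric.isTimelike_iff, h0, map_zero] at ht
  simp at ht

end Literature.Geometry.Lorentzian

end
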